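import Summits.Ventures.CertifiedArithmetic.Expansions.Orient2dAdaptZero
import Summits.Ventures.CertifiedArithmetic.Expansions.Orient2dTailsZero
import Mathlib.Tactic.Linarith
import Mathlib.Tactic.NormNum
import Mathlib.Tactic.Positivity
import Mathlib.Tactic.Ring

/-!
# ORIENT2D answers `0` exactly when the determinant is `0`

NEW WORK in the sense of this development (statement and proof ours; no published counterpart
claimed).  The GLUE announced in `Orient2dTailsZero`: under the hypotheses of
`Orient2dAdapt.orient2dAdapt_sign` (p ≥ 4; odd round-to-nearest with `RoundoffBelow 2`; `FesSpec`
expansion sum; error-free two-product on `F(p, e₀)`; coordinates in `F(p, e₀)` with `emin ≤ e₀` and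
`emin + 3p ≤ 2e₀`; the published coefficients), Shewchuk's `orient2d` [Shewchuk1997, Fig. 21 /
predicates.c] answers `0` IF AND ONLY IF the true determinant is `0` — and hence, with
`orient2dAdapt_sign`, its answer always has the SIGN of the true determinant.

* `two_zpow_le_mul_of_pos` / `two_zpow_le_fl_mul_of_pos` / `fl_mul_le_neg_two_zpow_of_neg` — a
  nonzero product of two floats of `F(p, e₀)` is a multiple of `2^(2e₀)`, so its rounding is at
  least `2^(2e₀)` in absolute value: the size hypothesis of the tails-zero theorem is automatic.
* `twoTwoProdDiff_estimate_eq_zero_sum_neg` — the tails-zero theorem for two NEGATIVE rounded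
  products (odd rounding), by running `tailsZero_core` on the negated chain.
* `orient2dAdapt_eq_zero_iff` — `r = 0 ↔ t_A = 0`; `orient2dAdapt_sign_iff'` — the unconditional
  sign characterisation; instances `orient2dAdapt_fma_sign_iff` (ties-to-even, `2Prod_FMA`,
  `fast_expansion_sum_zeroelim`) and `orient2dAdapt_dekker_sign_iff` (the algorithm as printed:
  Dekker's TWO-PRODUCT with SPLIT, in Theorem 18's no-underflow regime) and the IEEE binary64
  corollary `orient2dAdapt_binary64_sign_iff` (`p = 53`, `emin = −1074`, `s = 27`, grid exponent
  `e₀ ≥ −457`).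
-/

namespace Summit.Ventures.CertifiedArithmetic.Expansions

open Literature.ComputerArithmetic.JeannerodRump2018
open Literature.ComputerArithmetic.BoldoJeannerodMelquiondMuller2023 hiding twoSum twoSum_fst
  isFloat_twoSum
open Literature.ComputerArithmetic.Shewchuk1997
open Literature.ComputerArithmetic.RumpOgitaOishi2008 (add_eq_zero_of_fl_add_eq_zero)

variable {p : ℕ} {emin : ℤ} {fl : ℚ → ℚ}

/-- A positive product of two floats of `F(p, e₀)` is at least `2^(2e₀)`. -/
theorem two_zpow_le_mul_of_pos {e₀ : ℤ} {x y : ℚ} (hx : IsFloat p e₀ x) (hy : IsFloat p e₀ y)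
    (h : 0 < x * y) : (2 : ℚ) ^ (e₀ + e₀) ≤ x * y := by
  obtain ⟨M, a, -, ha, rfl⟩ := hx
  obtain ⟨N, b, -, hb, rfl⟩ := hy
  have h2 : (0 : ℚ) < 2 := by norm_num
  have hab : (0 : ℚ) < 2 ^ (a + b) := zpow_pos h2 _
  have heq : (M : ℚ) * 2 ^ a * ((N : ℚ) * 2 ^ b) = ((M * N : ℤ) : ℚ) * 2 ^ (a + b) := by
    push_cast; rw [zpow_add₀ (ne_of_gt h2)]; ring
  rw [heq] at h ⊢
  have hMN : (0 : ℚ) < ((M * N : ℤ) : ℚ) := by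
    by_contra hle
    have : ((M * N : ℤ) : ℚ) * 2 ^ (a + b) ≤ 0 :=
      mul_nonpos_of_nonpos_of_nonneg (not_lt.mp hle) hab.le
    linarith
  have hMN1 : (1 : ℚ) ≤ ((M * N : ℤ) : ℚ) := by
    exact_mod_cast (show (0 : ℤ) < M * N by exact_mod_cast hMN)
  calc (2 : ℚ) ^ (e₀ + e₀) ≤ 2 ^ (a + b) := zpow_le_zpow_right₀ (by norm_num) (by omega)
    _ = 1 * 2 ^ (a + b) := (one_mul _).symm
    _ ≤ ((M * N : ℤ) : ℚ) * 2 ^ (a + b) := mul_le_mul_of_nonneg_right hMN1 hab.le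

/-- If the ROUNDED product of two floats of `F(p, e₀)` is positive it is at least `2^(2e₀)`
(`2e₀ ≥ emin`). -/
theorem two_zpow_le_fl_mul_of_pos (hp : 1 ≤ p) (hfl : IsRoundNearest p emin fl) {e₀ : ℤ}
    (he : emin ≤ e₀ + e₀) {x y : ℚ} (hx : IsFloat p e₀ x) (hy : IsFloat p e₀ y)
    (h : 0 < fl (x * y)) : (2 : ℚ) ^ (e₀ + e₀) ≤ fl (x * y) := by
  have hpos : 0 < x * y := by
    by_contra hle
    have := fl_le_of_le hfl (isFloat_zero p emin) (not_lt.mp hle)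
    linarith
  have hF : IsFloat p emin ((2 : ℚ) ^ (e₀ + e₀)) := by
    have h1 : |(1 : ℤ)| < 2 ^ p := by
      rw [abs_one]; exact one_lt_pow₀ (by norm_num) (by omega)
    have := isFloat_of_int_mul (p := p) 1 (e₀ + e₀) h1 he
    simpa using this
  exact le_fl_of_le hfl hF (two_zpow_le_mul_of_pos hx hy hpos)

/-- … and if it is negative it is at most `−2^(2e₀)` (odd rounding). -/
theorem fl_mul_le_neg_two_zpow_of_neg (hp : 1 ≤ p) (hfl : IsRoundNearest p emin fl)
    (hodd : ∀ t, fl (-t) = -fl t) {e₀ : ℤ} (he : emin ≤ e₀ + e₀) {x y : ℚ} (hx : IsFloat p e₀ x)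
    (hy : IsFloat p e₀ y) (h : fl (x * y) < 0) : fl (x * y) ≤ -(2 : ℚ) ^ (e₀ + e₀) := by
  have h' : 0 < fl ((-x) * y) := by rw [neg_mul, hodd]; linarith
  have := two_zpow_le_fl_mul_of_pos hp hfl he hx.neg hy h'
  rw [neg_mul, hodd] at this
  linarith

/-- **BLOCK FORM, NEGATIVE PRODUCTS** (odd rounding): error-free two-products of floats, both
rounded products at most `−2^(emin+2p+2)`, `estimate` of the TWO-TWO-DIFF block `0` ⟹ the exact
difference of the products is `0` — `tailsZero_core` applied to the negated chain. -/
theorem twoTwoProdDiff_estimate_eq_zero_sum_neg (hp : 4 ≤ p) (hfl : IsRoundNearest p emin fl)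
    (hodd : ∀ t, fl (-t) = -fl t) (hfl2 : RoundoffBelow 2 fl) {tp : ℚ → ℚ → ℚ × ℚ}
    {x₁ x₂ x₃ x₄ : ℚ} (h₁₂ : ExactTwoProd p emin fl tp x₁ x₂)
    (h₃₄ : ExactTwoProd p emin fl tp x₃ x₄) (hA : fl (x₁ * x₂) ≤ -(2 : ℚ) ^ (emin + 2 * p + 2))
    (hB : fl (x₃ * x₄) ≤ -(2 : ℚ) ^ (emin + 2 * p + 2))
    (hz : estimate fl (twoTwoProdDiff tp fl x₁ x₂ x₃ x₄) = 0) : x₁ * x₂ - x₃ * x₄ = 0 := by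
  have hp1 : 1 ≤ p := (by omega); have hp2 : 2 ≤ p := by omega
  obtain ⟨hW, hS, -, -⟩ := twoTwoProdDiff_spec hp1 hfl hfl2 h₁₂ h₃₄
  rw [← hS]
  obtain ⟨hA1, hAs, hFa⟩ := h₁₂
  obtain ⟨hB1, hBs, hFb⟩ := h₃₄
  unfold twoTwoProdDiff at hW hz ⊢
  obtain ⟨B₀, B₁, B₃, hBlk, hQ, hF₀, hF₁, -, -⟩ :=
    twoTwoDiff_estimate_eq_zero hp2 hfl hW.isExpansion hz
  rw [hBlk]
  simp only [List.sum_cons, List.sum_nil, add_zero]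
  set A := (tp x₁ x₂).1 with hAdef
  set a₀ := (tp x₁ x₂).2 with ha₀def
  set B := (tp x₃ x₄).1 with hBdef
  set b₀ := (tp x₃ x₄).2 with hb₀def
  have hFA : IsFloat p emin A := by rw [hA1]; exact (hfl _).1
  have hFB : IsFloat p emin B := by rw [hB1]; exact (hfl _).1
  have hAe : fl (A + a₀) = A := by rw [hAs, ← hA1]
  have hBe : fl (B + b₀) = B := by rw [hBs, ← hB1]
  rw [← hA1] at hA
  rw [← hB1] at hB
  rw [twoTwoDiff_eq] at hBlk
  simp only [List.cons.injEq, and_true] at hBlk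
  obtain ⟨e1, e2, e3, e4⟩ := hBlk
  set i := (twoSum fl (-b₀) a₀).1 with hidef
  set j := (twoSum fl i A).1 with hjdef
  have hFi : IsFloat p emin i := (isFloat_twoSum hfl (-b₀) a₀).1
  have hz₀ : (twoSum fl i A).2 = i + A - j := by
    rw [(twoSum_exact hp1 hfl hFi hFA).1, hjdef, twoSum_fst]
  rw [hz₀] at e2 e3 e4
  set i' := (twoSum fl (-B) (i + A - j)).1 with hi'def
  have hFi' : IsFloat p emin i' := (isFloat_twoSum hfl (-B) (i + A - j)).1
  have hFj : IsFloat p emin j := (isFloat_twoSum hfl i A).1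
  have hFz : IsFloat p emin (i + A - j) := hz₀ ▸ (isFloat_twoSum hfl i A).2
  have hB₃ : B₃ = i' + j := by
    have h := (twoSum_exact hp1 hfl hFi' hFj).2
    rw [e3, e4, add_zero] at h
    exact h
  have hB₀ : B₀ = -b₀ + a₀ - i := by
    rw [← e1, (twoSum_exact hp1 hfl hFb.neg hFa).1, hidef, twoSum_fst]
  have hB₁ : B₁ = -B + (i + A - j) - i' := by
    rw [← e2, (twoSum_exact hp1 hfl hFB.neg hFz).1, hi'def, twoSum_fst]
  have hi0 : fl (-b₀ + a₀) = i := by rw [hidef, twoSum_fst]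
  have hj0 : fl (i + A) = j := by rw [hjdef, twoSum_fst]
  have hi'0 : fl (-B + (i + A - j)) = i' := by rw [hi'def, twoSum_fst]
  -- the negated chain is the chain of the negated data (odd rounding)
  have hcore : -i' + -j = 0 := by
    refine tailsZero_core (A := -A) (a₀ := -a₀) (B := -B) (b₀ := -b₀) (i := -i) (j := -j)
      (i' := -i') hp hfl hFA.neg hFa.neg hFB.neg hFb.neg ?_ ?_ (by linarith) (by linarith)
      ?_ ?_ ?_ ?_
    · rw [show -A + -a₀ = -(A + a₀) by ring, hodd, hAe]
    · rw [show -B + -b₀ = -(B + b₀) by ring, hodd, hBe]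
    · rw [show -(-b₀) + -a₀ = -(-b₀ + a₀) by ring, hodd, hi0]
    · rw [show -i + -A = -(i + A) by ring, hodd, hj0]
    · rw [show -(-B) + (-i + -A - -j) = -(-B + (i + A - j)) by ring, hodd, hi'0]
    · rw [show -(-b₀) + -a₀ - -i + (-(-B) + (-i + -A - -j) - -i') =
          -((-b₀ + a₀ - i) + (-B + (i + A - j) - i')) by ring, hodd, ← hB₀, ← hB₁, hQ, hB₃]
      ring
  have hB₃0 : B₃ = 0 := by rw [hB₃]; linarith
  rw [hB₃0, neg_zero] at hQ
  have := add_eq_zero_of_fl_add_eq_zero hp1 hfl hF₀ hF₁ hQ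
  linarith

/-- **`orient2d` ANSWERS `0` IFF THE DETERMINANT IS `0`** (hypotheses of `orient2dAdapt_sign`). -/
theorem orient2dAdapt_eq_zero_iff (hp : 4 ≤ p) (hfl : IsRoundNearest p emin fl)
    (hodd : ∀ t, fl (-t) = -fl t) (hfl2 : RoundoffBelow 2 fl)
    {fes : List ℚ → List ℚ → List ℚ} (hfes : FesSpec p emin fes) {e₀ : ℤ} (he₀ : emin ≤ e₀)
    (h3 : emin + 3 * p ≤ e₀ + e₀) {tp : ℚ → ℚ → ℚ × ℚ}
    (htp : ∀ x y, IsFloat p e₀ x → IsFloat p e₀ y → ExactTwoProd p emin fl tp x y)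
    {a₁ a₂ b₁ b₂ c₁ c₂ : ℚ} (ha₁ : IsFloat p e₀ a₁) (ha₂ : IsFloat p e₀ a₂) (hb₁ : IsFloat p e₀ b₁)
    (hb₂ : IsFloat p e₀ b₂) (hc₁ : IsFloat p e₀ c₁) (hc₂ : IsFloat p e₀ c₂) :
    orient2dAdapt fes tp fl (ccwerrboundA p) (ccwerrboundB p) (ccwerrboundC p)
        (resulterrbound p) a₁ a₂ b₁ b₂ c₁ c₂ = 0 ↔ orient2dDet a₁ a₂ b₁ b₂ c₁ c₂ = 0 := by
  have hp1 : 1 ≤ p := (by omega); have hp2 : 2 ≤ p := by omega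
  have hsign := orient2dAdapt_sign hp hfl hodd hfl2 hfes he₀ h3 htp ha₁ ha₂ hb₁ hb₂ hc₁ hc₂
  refine ⟨fun hr => ?_, fun ht => ?_⟩
  · rcases orient2dAdapt_eq_zero hp hfl hodd hfl2 hfes he₀ h3 htp ha₁ ha₂ hb₁ hb₂ hc₁ hc₂ hr with
      h0 | ⟨hF1, hF2, hF3, hF4, -⟩
    · exact h0
    · -- the tails-zero exit: recover `det_B = 0` and the signs of the rounded products
      have f1 : fl (a₁ - c₁) = a₁ - c₁ := fl_eq_self hfl hF1
      have f2 : fl (b₂ - c₂) = b₂ - c₂ := fl_eq_self hfl hF2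
      have f3 : fl (a₂ - c₂) = a₂ - c₂ := fl_eq_self hfl hF3
      have f4 : fl (b₁ - c₁) = b₁ - c₁ := fl_eq_self hfl hF4
      have fmt : ∀ {x y : ℚ}, IsFloat p e₀ x → IsFloat p e₀ y → IsFloat p e₀ (fl (x - y)) :=
        fun hx hy => isFloat_of_isFloat_of_onGrid (hfl _).1
          (((OnGrid.of_isFloat hx).sub (OnGrid.of_isFloat hy)).fl_of hp1 hfl he₀)
      have g1 : IsFloat p e₀ (a₁ - c₁) := f1 ▸ fmt ha₁ hc₁
      have g2 : IsFloat p e₀ (b₂ - c₂) := f2 ▸ fmt hb₂ hc₂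
      have g3 : IsFloat p e₀ (a₂ - c₂) := f3 ▸ fmt ha₂ hc₂
      have g4 : IsFloat p e₀ (b₁ - c₁) := f4 ▸ fmt hb₁ hc₁
      have h₁₂ : ExactTwoProd p emin fl tp (a₁ - c₁) (b₂ - c₂) := htp _ _ g1 g2
      have h₃₄ : ExactTwoProd p emin fl tp (a₂ - c₂) (b₁ - c₁) := htp _ _ g3 g4
      -- which exit produced the `0`?  Stages A–C never answer `0` unless `t_A = 0`.
      rcases hA : orient2dStageA fl (ccwerrboundA p) a₁ a₂ b₁ b₂ c₁ c₂ with _ | d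
      · rcases hB : orient2dStageB tp fl (ccwerrboundB p) (orient2dDetsum fl a₁ a₂ b₁ b₂ c₁ c₂)
            a₁ a₂ b₁ b₂ c₁ c₂ with _ | d
        · have hT : (a₁ - c₁) - fl (a₁ - c₁) = 0 ∧ (b₂ - c₂) - fl (b₂ - c₂) = 0 ∧
              (a₂ - c₂) - fl (a₂ - c₂) = 0 ∧ (b₁ - c₁) - fl (b₁ - c₁) = 0 := by
            refine ⟨?_, ?_, ?_, ?_⟩ <;> linarith
          rw [orient2dAdapt_of_tailsZero hA hB hT] at hr
          have he2 : emin ≤ e₀ + e₀ := by omega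
          have hpow : (2 : ℚ) ^ (emin + 2 * p + 2) ≤ 2 ^ (e₀ + e₀) :=
            zpow_le_zpow_right₀ (by norm_num) (by omega)
          have hsg := orient2dStageA_eq_none hA
          rw [f1, f2, f3, f4] at hsg
          unfold orient2dDet
          rcases hsg with ⟨hL, hR⟩ | ⟨hL, hR⟩
          · exact orient2d_tailsZero_det_eq_zero hp hfl hfl2 hF1 hF2 hF3 hF4 h₁₂ h₃₄
              (hpow.trans (two_zpow_le_fl_mul_of_pos hp1 hfl he2 g1 g2 hL))
              (hpow.trans (two_zpow_le_fl_mul_of_pos hp1 hfl he2 g3 g4 hR)) hr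
          · unfold orient2dDetB at hr
            rw [f1, f2, f3, f4] at hr
            exact twoTwoProdDiff_estimate_eq_zero_sum_neg hp hfl hodd hfl2 h₁₂ h₃₄
              (by linarith [fl_mul_le_neg_two_zpow_of_neg hp1 hfl hodd he2 g1 g2 hL])
              (by linarith [fl_mul_le_neg_two_zpow_of_neg hp1 hfl hodd he2 g3 g4 hR]) hr
        · exact eq_zero_of_sign_iff
            (orient2dStageB_correct hp hfl hfl2 he₀ (by omega) ha₁ ha₂ hb₁ hb₂ hc₁ hc₂
              (f1.symm ▸ f2.symm ▸ h₁₂) (f3.symm ▸ f4.symm ▸ h₃₄) hA hB)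
            (by rw [orient2dAdapt_of_stageB hA hB] at hr; exact hr)
      · exact eq_zero_of_sign_iff
          (orient2dStageA_correct hp hfl he₀ (by omega) ha₁ ha₂ hb₁ hb₂ hc₁ hc₂ hA)
          (by rw [orient2dAdapt_of_stageA hA] at hr; exact hr)
  · by_contra hr
    rcases lt_or_gt_of_ne hr with hneg | hpos
    · have := hsign.2 hneg; linarith
    · have := hsign.1 hpos; linarith

/-- **THE SIGN OF `orient2d` IS THE SIGN OF THE DETERMINANT, UNCONDITIONALLY** (hypotheses of
`orient2dAdapt_sign`): `r > 0 ↔ t_A > 0`, `r < 0 ↔ t_A < 0`, `r = 0 ↔ t_A = 0`. -/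
theorem orient2dAdapt_sign_iff' (hp : 4 ≤ p) (hfl : IsRoundNearest p emin fl)
    (hodd : ∀ t, fl (-t) = -fl t) (hfl2 : RoundoffBelow 2 fl)
    {fes : List ℚ → List ℚ → List ℚ} (hfes : FesSpec p emin fes) {e₀ : ℤ} (he₀ : emin ≤ e₀)
    (h3 : emin + 3 * p ≤ e₀ + e₀) {tp : ℚ → ℚ → ℚ × ℚ}
    (htp : ∀ x y, IsFloat p e₀ x → IsFloat p e₀ y → ExactTwoProd p emin fl tp x y)
    {a₁ a₂ b₁ b₂ c₁ c₂ : ℚ} (ha₁ : IsFloat p e₀ a₁) (ha₂ : IsFloat p e₀ a₂) (hb₁ : IsFloat p e₀ b₁)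
    (hb₂ : IsFloat p e₀ b₂) (hc₁ : IsFloat p e₀ c₁) (hc₂ : IsFloat p e₀ c₂) :
    (0 < orient2dAdapt fes tp fl (ccwerrboundA p) (ccwerrboundB p) (ccwerrboundC p)
        (resulterrbound p) a₁ a₂ b₁ b₂ c₁ c₂ ↔ 0 < orient2dDet a₁ a₂ b₁ b₂ c₁ c₂) ∧
      (orient2dAdapt fes tp fl (ccwerrboundA p) (ccwerrboundB p) (ccwerrboundC p)
        (resulterrbound p) a₁ a₂ b₁ b₂ c₁ c₂ < 0 ↔ orient2dDet a₁ a₂ b₁ b₂ c₁ c₂ < 0) ∧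
      (orient2dAdapt fes tp fl (ccwerrboundA p) (ccwerrboundB p) (ccwerrboundC p)
        (resulterrbound p) a₁ a₂ b₁ b₂ c₁ c₂ = 0 ↔ orient2dDet a₁ a₂ b₁ b₂ c₁ c₂ = 0) := by
  have hsign := orient2dAdapt_sign hp hfl hodd hfl2 hfes he₀ h3 htp ha₁ ha₂ hb₁ hb₂ hc₁ hc₂
  have hzero := orient2dAdapt_eq_zero_iff hp hfl hodd hfl2 hfes he₀ h3 htp ha₁ ha₂ hb₁ hb₂ hc₁ hc₂
  refine ⟨⟨hsign.1, fun ht => ?_⟩, ⟨hsign.2, fun ht => ?_⟩, hzero⟩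
  · by_contra hr
    rcases lt_or_eq_of_le (not_lt.mp hr) with hneg | hz
    · have := hsign.2 hneg; linarith
    · have := hzero.1 hz; linarith
  · by_contra hr
    rcases lt_or_eq_of_le (not_lt.mp hr) with hpos | hz
    · have := hsign.1 hpos; linarith
    · have := hzero.1 hz.symm; linarith

/-! ## The instances: ties-to-even, `predicates.c`'s expansion sum, FMA or Dekker two-product -/

/-- **`orient2d` with ties-to-even, `2Prod_FMA` and `fast_expansion_sum_zeroelim` RETURNS THE SIGN
OF THE DETERMINANT, ZERO INCLUDED** (the binary64 build of `predicates.c` on FMA hardware, scaled to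
precision `p ≥ 4`): coordinates in `F(p, e₀)` with `emin ≤ e₀` and `emin + 3p ≤ 2e₀`. -/
theorem orient2dAdapt_fma_sign_iff (hp : 4 ≤ p) {e₀ : ℤ} (he₀ : emin ≤ e₀)
    (h3 : emin + 3 * p ≤ e₀ + e₀) {a₁ a₂ b₁ b₂ c₁ c₂ : ℚ} (ha₁ : IsFloat p e₀ a₁)
    (ha₂ : IsFloat p e₀ a₂) (hb₁ : IsFloat p e₀ b₁) (hb₂ : IsFloat p e₀ b₂) (hc₁ : IsFloat p e₀ c₁)
    (hc₂ : IsFloat p e₀ c₂) :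
    let r := orient2dAdapt (fastExpansionSumZeroElimC (roundTiesEven p emin))
      (twoProdFMA (roundTiesEven p emin)) (roundTiesEven p emin) (ccwerrboundA p) (ccwerrboundB p)
      (ccwerrboundC p) (resulterrbound p) a₁ a₂ b₁ b₂ c₁ c₂
    (0 < r ↔ 0 < orient2dDet a₁ a₂ b₁ b₂ c₁ c₂) ∧ (r < 0 ↔ orient2dDet a₁ a₂ b₁ b₂ c₁ c₂ < 0) ∧
      (r = 0 ↔ orient2dDet a₁ a₂ b₁ b₂ c₁ c₂ = 0) := by
  intro r
  have hp1 : 1 ≤ p := le_trans (by norm_num) hp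
  have h2 : emin ≤ e₀ + e₀ := by omega
  have hfl : IsRoundNearest p emin (roundTiesEven p emin) := isRoundNearest_roundTiesEven hp1
  have hodd : ∀ t, roundTiesEven p emin (-t) = -roundTiesEven p emin t :=
    Literature.ComputerArithmetic.GraillatMuller2025.roundTiesEven_neg
  have hfl2 : RoundoffBelow 2 (roundTiesEven p emin) := roundoffBelow_two_roundTiesEven p emin
  have hfes := fesSpec_fastExpansionSumZeroElimC hp hfl hfl2
  have htp : ∀ x y, IsFloat p e₀ x → IsFloat p e₀ y →
      ExactTwoProd p emin (roundTiesEven p emin) (twoProdFMA (roundTiesEven p emin)) x y :=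
    fun x y hx hy => exactTwoProd_twoProdFMA hp1 hfl h2 hx hy
  exact orient2dAdapt_sign_iff' hp hfl hodd hfl2 hfes he₀ h3 htp ha₁ ha₂ hb₁ hb₂ hc₁ hc₂

/-- **`orient2d` AS PRINTED — ties-to-even, Dekker's TWO-PRODUCT with SPLIT point `s`
(`p ≤ 2s ≤ p + 1`), `fast_expansion_sum_zeroelim` — RETURNS THE SIGN OF THE DETERMINANT, ZERO
INCLUDED**, for coordinates in `F(p, e₀)` in the no-underflow regime of Theorem 18
(`emin + p − 1 ≤ e₀`) with `emin + 3p ≤ 2e₀`; `p ≥ 4`. [Shewchuk1997, Fig. 21 with Thm 18's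
TWO-PRODUCT; predicates.c `orient2d`] -/
theorem orient2dAdapt_dekker_sign_iff (hp : 4 ≤ p) {s : ℕ} (hs2 : p ≤ 2 * s)
    (hs2' : 2 * s ≤ p + 1) {e₀ : ℤ} (h1 : emin + p - 1 ≤ e₀) (h3 : emin + 3 * p ≤ e₀ + e₀)
    {a₁ a₂ b₁ b₂ c₁ c₂ : ℚ} (ha₁ : IsFloat p e₀ a₁) (ha₂ : IsFloat p e₀ a₂) (hb₁ : IsFloat p e₀ b₁)
    (hb₂ : IsFloat p e₀ b₂) (hc₁ : IsFloat p e₀ c₁) (hc₂ : IsFloat p e₀ c₂) :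
    let r := orient2dAdapt (fastExpansionSumZeroElimC (roundTiesEven p emin))
      (twoProduct (roundTiesEven p emin) s) (roundTiesEven p emin) (ccwerrboundA p)
      (ccwerrboundB p) (ccwerrboundC p) (resulterrbound p) a₁ a₂ b₁ b₂ c₁ c₂
    (0 < r ↔ 0 < orient2dDet a₁ a₂ b₁ b₂ c₁ c₂) ∧ (r < 0 ↔ orient2dDet a₁ a₂ b₁ b₂ c₁ c₂ < 0) ∧
      (r = 0 ↔ orient2dDet a₁ a₂ b₁ b₂ c₁ c₂ = 0) := by
  intro r
  have hp1 : 1 ≤ p := le_trans (by norm_num) hp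
  have he₀ : emin ≤ e₀ := by omega
  have h2 : emin + 2 * p - 1 ≤ e₀ + e₀ := by omega
  have hfl : IsRoundNearest p emin (roundTiesEven p emin) := isRoundNearest_roundTiesEven hp1
  have hodd : ∀ t, roundTiesEven p emin (-t) = -roundTiesEven p emin t :=
    Literature.ComputerArithmetic.GraillatMuller2025.roundTiesEven_neg
  have hfl2 : RoundoffBelow 2 (roundTiesEven p emin) := roundoffBelow_two_roundTiesEven p emin
  have hfes := fesSpec_fastExpansionSumZeroElimC hp hfl hfl2
  have htp : ∀ x y, IsFloat p e₀ x → IsFloat p e₀ y →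
      ExactTwoProd p emin (roundTiesEven p emin) (twoProduct (roundTiesEven p emin) s) x y :=
    fun x y hx hy => exactTwoProd_twoProduct hp hs2 hs2' hfl hodd h1 h2 hx hy
  exact orient2dAdapt_sign_iff' hp hfl hodd hfl2 hfes he₀ h3 htp ha₁ ha₂ hb₁ hb₂ hc₁ hc₂

/-- **IEEE binary64** (`p = 53`, `emin = −1074`, ties-to-even; Dekker's TWO-PRODUCT with Shewchuk's
`splitter` exponent `s = 27`; `predicates.c`'s `fast_expansion_sum_zeroelim` and coefficients): for
input coordinates that are binary64 numbers on a common grid `2^e₀ · ℤ` with `|coordinate| <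
2^(e₀ + 53)` and `e₀ ≥ −457`, `orient2d` returns a number with EXACTLY the sign of the true
determinant (zero included). -/
theorem orient2dAdapt_binary64_sign_iff {e₀ : ℤ} (he : -457 ≤ e₀) {a₁ a₂ b₁ b₂ c₁ c₂ : ℚ}
    (ha₁ : IsFloat 53 e₀ a₁) (ha₂ : IsFloat 53 e₀ a₂) (hb₁ : IsFloat 53 e₀ b₁)
    (hb₂ : IsFloat 53 e₀ b₂) (hc₁ : IsFloat 53 e₀ c₁) (hc₂ : IsFloat 53 e₀ c₂) :
    let r := orient2dAdapt (fastExpansionSumZeroElimC (roundTiesEven 53 (-1074)))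
      (twoProduct (roundTiesEven 53 (-1074)) 27) (roundTiesEven 53 (-1074)) (ccwerrboundA 53)
      (ccwerrboundB 53) (ccwerrboundC 53) (resulterrbound 53) a₁ a₂ b₁ b₂ c₁ c₂
    (0 < r ↔ 0 < orient2dDet a₁ a₂ b₁ b₂ c₁ c₂) ∧ (r < 0 ↔ orient2dDet a₁ a₂ b₁ b₂ c₁ c₂ < 0) ∧
      (r = 0 ↔ orient2dDet a₁ a₂ b₁ b₂ c₁ c₂ = 0) :=
  orient2dAdapt_dekker_sign_iff (p := 53) (emin := -1074) (by norm_num) (by norm_num) (by norm_num)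
    (by push_cast; omega) (by push_cast; omega) ha₁ ha₂ hb₁ hb₂ hc₁ hc₂

end Summit.Ventures.CertifiedArithmetic.Expansions
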